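import Mathlib
import Literature.NumberTheory.LFunctions.Zhang2022.SkeletonPartThree
import Literature.NumberTheory.LFunctions.Zhang2022.TypedAppendixB
import Literature.NumberTheory.LFunctions.Zhang2022.SkeletonAlpha1
import Literature.NumberTheory.LFunctions.Zhang2022.AppendixBLemma151Circles
import Literature.Analysis.Complex.RectangleResidueDoublePoles

/-!
# Zhang (2022) Appendix B, proof of Lemma 15.1: the line-to-circle step ("In a way similar to the
# proof of Lemma 8.1 … the sum of the residues … plus an acceptable error"), GENERIC in `(P_μ, β)` —
# Part I: the small rectangle around the poles carries the circle integral

Topic `Literature/NumberTheory/LFunctions/Zhang2022` (Landau–Siegel audit tree; verdict-neutral).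
Y. Zhang, *Discrete mean estimates and the Landau–Siegel zero*, arXiv:2211.02515v1 (2022)
[Zhang2022LandauSiegel] — **an unrefereed manuscript under adjudication; nothing in this file asserts
any claim of the manuscript beyond the identities it PROVES.** ZHANG-L discharge lane (WP15, App. B
blocks B1/B3/B4 under leaf `Typed.Section15C.Eq15_22` / Lemma 15.1 χR), DAG node `Z22:§B.u009` (text
after the display) [Z22 p.107, tex L5298] and its `μ = 3`, `μ = 1` twins (tex L5310–L5311): for the
Perron integrand `F(s) = ζ(1+s)/ζ(1+s−β_j)·(P_μ/l₁)ˢ/((log P_μ)(s−β)²)` (`zetaRatio c′ D j s * kerB P_μ β l₁ s`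
of `TypedAppendixB`, at `(P_μ, β) = (P₂, β₇), (P₃, β₆), (P₁, β₆)`), "the right side is equal to the sum of
the residues of the integrand at `s = 0` and `s = β` plus an acceptable error".

This file is the `(P_μ, β)`-GENERIC form of the residue step (the `μ = 2` original is zl-w15-p3's
`Skeleton.intB2_rect_eq_circle`, `AppendixBLemma151LineShiftRect`; this is its parameter lift, same
proof): for `D` large, ANY `P_μ > 1`, `l₁ ≥ 1` and ANY purely imaginary `β ≠ 0`, `β ≠ β_j`, `‖β‖ ≤ 3α`,

* `zetaRatio_mul_kerB_eq_G_div`, `differentiableOn_G_gen`, `circleIntegral_zetaRatio_kerB_eq_G` — the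
  `G`-form `F(s) = G(s)/(s(s−β)²)`, `G(s) = ζ₁(1+s)(s−β_j)ζ₁(1+s−β_j)⁻¹(P_μ/l₁)ˢ/log P_μ` holomorphic near `0`;
* `circleIntegral_five_alpha_eq_gen` — `(2πi)⁻¹∮_{|s|=5α} F = G(0)/β² − G(β)/β² + G′(β)/β`
  (`Skeleton.cauchy_three_term`);
* `rect_eq_circle_gen` — there is an absolute `δ₀ > 0` such that for every `0 < ε ≤ δ₀`,
  `∮_{∂([−δ₀, ε] × [−δ₀, δ₀])} F = ∮_{|s|=5α} F` (rectangle residue theorem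
  `Literature.Analysis.Complex.rectBoundaryIntegral_eq_sum_of_doublePoles`; the typed `F` carries Mathlib's
  junk value of `ζ(1)` at the removable point `s = β_j`, handled as a pole with zero residue), and
  `rect_eq_circle_gen_of_le` (boxes of any smaller half-size `0 < δ′ ≤ δ₀`).

Part II (the shift of `Re s = 1` to the box and the bounds `O(1/log P_μ)` for the tails and sides, i.e.
the generic `StepB_u009rR`: `vline_zetaRatio_kerB_sub_circle_le`) is the companion file
`AppendixBLineToCircleGeneric.lean`.

WHAT THIS IS NOT: the residue VALUES, Lemma 15.1, or any claim about Theorems 1–2 / Landau–Siegel zeros.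

## References

* Y. Zhang, arXiv:2211.02515v1 (2022), App. B p. 107. [cite: Zhang2022LandauSiegel, App. B p.107]
* J. B. Conway, *Functions of One Complex Variable I*, GTM 11, Ch. V §2 (residue theorem). [Conway1978]
-/

noncomputable section

open Complex Real Metric Set Filter Topology

namespace Literature.NumberTheory.LFunctions.Zhang2022.Typed.AppendixB

open Literature.NumberTheory.LFunctions.Zhang2022.Skeleton
open Literature.Analysis.Complex (rectBoundaryIntegral rectBoundaryIntegral_eq_sum_of_doublePoles
  doublePole_data_of_simplePole)

section GForm

variable (c' : ℝ)

/-- The `G`-form of the generic integrand: for `s ≠ 0`, `s ≠ β_j` (with `ζ₁(1+s−β_j) ≠ 0`, `log P_μ ≠ 0`),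
`ζ(1+s)/ζ(1+s−β_j)·(P_μ/l₁)ˢ/((log P_μ)(s−β)²) = G(s)/(s(s−β)²)` with
`G(s) = ζ₁(1+s)(s−β_j)ζ₁(1+s−β_j)⁻¹(P_μ/l₁)ˢ/log P_μ` (`ζ(1+s) = s⁻¹ζ₁(1+s)`, Mathlib
`riemannZeta_eq_inv_sub_mul`). [cite: Zhang2022LandauSiegel, App. B p.107] -/
theorem zetaRatio_mul_kerB_eq_G_div (D j : ℕ) (Pμ : ℝ) (β : ℂ) (l₁ : ℕ) {s : ℂ} (hs0 : s ≠ 0)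
    (hsb : s ≠ betaJ c' D j) (hz : riemannZeta₁ (1 + s - betaJ c' D j) ≠ 0)
    (hL : (Real.log Pμ : ℂ) ≠ 0) :
    zetaRatio c' D j s * kerB Pμ β l₁ s =
      (riemannZeta₁ (1 + s) * (s - betaJ c' D j) * (riemannZeta₁ (1 + s - betaJ c' D j))⁻¹ *
        ((Pμ / l₁ : ℝ) : ℂ) ^ s / (Real.log Pμ : ℂ)) / (s * (s - β) ^ 2) := by
  have h1 : (1 : ℂ) + s ≠ 1 := fun h => hs0 (by linear_combination h)
  have h2 : (1 : ℂ) + s - betaJ c' D j ≠ 1 := fun h => hsb (by linear_combination h)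
  rw [zetaRatio, kerB, riemannZeta_eq_inv_sub_mul h1, riemannZeta_eq_inv_sub_mul h2]
  have e1 : (1 : ℂ) + s - 1 = s := by ring
  have e2 : (1 : ℂ) + s - betaJ c' D j - 1 = s - betaJ c' D j := by ring
  rw [e1, e2]
  have hsb' : s - betaJ c' D j ≠ 0 := sub_ne_zero.mpr hsb
  field_simp

/-- The circle integrals of the generic integrand do not see the removable point `s = β_j`: over any
circle not passing through `0` on which `ζ₁(1+s−β_j) ≠ 0`, `∮ F = ∮ G(s)/(s(s−β)²)` (a.e. congruence).
[cite: Zhang2022LandauSiegel, App. B p.107] -/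
theorem circleIntegral_zetaRatio_kerB_eq_G (D j : ℕ) (Pμ : ℝ) (β : ℂ) (l₁ : ℕ) {c : ℂ} {R : ℝ}
    (hR : R ≠ 0) (h0 : ∀ θ : ℝ, circleMap c R θ ≠ 0)
    (hz : ∀ θ : ℝ, riemannZeta₁ (1 + circleMap c R θ - betaJ c' D j) ≠ 0)
    (hL : (Real.log Pμ : ℂ) ≠ 0) :
    (∮ s in C(c, R), zetaRatio c' D j s * kerB Pμ β l₁ s) = ∮ s in C(c, R),
      (riemannZeta₁ (1 + s) * (s - betaJ c' D j) * (riemannZeta₁ (1 + s - betaJ c' D j))⁻¹ *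
        ((Pμ / l₁ : ℝ) : ℂ) ^ s / (Real.log Pμ : ℂ)) / (s * (s - β) ^ 2) := by
  have hcount : (circleMap c R ⁻¹' {betaJ c' D j}).Countable :=
    (Set.countable_singleton _).preimage_circleMap c hR
  refine intervalIntegral.integral_congr_ae ((hcount.ae_notMem _).mono fun θ hθ _ => ?_)
  have hθ' : circleMap c R θ ≠ betaJ c' D j := hθ
  simp only [zetaRatio_mul_kerB_eq_G_div c' D j Pμ β l₁ (h0 θ) hθ' (hz θ) hL]

/-- `G` is holomorphic on `ball 0 r` as soon as `ζ₁(1+s−β_j) ≠ 0` there and `x = P_μ/l₁ > 0`.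
[cite: Zhang2022LandauSiegel, App. B p.107] -/
theorem differentiableOn_G_gen (D j : ℕ) {x : ℝ} (hx : 0 < x) (Lc : ℂ) {r : ℝ}
    (hz : ∀ s ∈ ball (0 : ℂ) r, riemannZeta₁ (1 + s - betaJ c' D j) ≠ 0) :
    DifferentiableOn ℂ (fun s : ℂ =>
      riemannZeta₁ (1 + s) * (s - betaJ c' D j) * (riemannZeta₁ (1 + s - betaJ c' D j))⁻¹ *
        ((x : ℝ) : ℂ) ^ s / Lc) (ball (0 : ℂ) r) := by
  have hx' : ((x : ℝ) : ℂ) ≠ 0 := by exact_mod_cast hx.ne'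
  have h1 : Differentiable ℂ fun s : ℂ => riemannZeta₁ (1 + s) :=
    differentiable_riemannZeta₁.comp (differentiable_id.const_add 1)
  have h2 : Differentiable ℂ fun s : ℂ => riemannZeta₁ (1 + s - betaJ c' D j) :=
    differentiable_riemannZeta₁.comp ((differentiable_id.const_add 1).sub_const _)
  have h3 : Differentiable ℂ fun s : ℂ => ((x : ℝ) : ℂ) ^ s :=
    fun s => differentiableAt_id.const_cpow (Or.inl hx')
  refine DifferentiableOn.div_const ?_ _
  refine ((h1.differentiableOn.mul (differentiableOn_id.sub_const _)).mul ?_).mul h3.differentiableOn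
  exact h2.differentiableOn.inv hz

/-- `L₀ ≤ log D` once `D ≥ ⌈exp L₀⌉₊`. [folklore] -/
private theorem le_ell_of_ceil_exp_le₅ {L₀ : ℝ} {D : ℕ} (hD : ⌈Real.exp L₀⌉₊ ≤ D) : L₀ ≤ ell D := by
  have h : Real.exp L₀ ≤ D := le_trans (Nat.le_ceil _) (by exact_mod_cast hD)
  exact (Real.le_log_iff_exp_le (lt_of_lt_of_le (Real.exp_pos _) h)).mpr h

/-- **The circle `|s| = 5α` in closed form, generic**: for `D` large (threshold from `zeta1_near_one`
and `c′`), every `j ∈ {1,2,3}`, `P_μ > 1`, `l₁ ≥ 1` and every `β ≠ 0` with `‖β‖ ≤ 3α`: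
`(2πi)⁻¹∮_{|s|=5α} ζ(1+s)/ζ(1+s−β_j)·(P_μ/l₁)ˢ/((log P_μ)(s−β)²) ds = G(0)/β² − G(β)/β² + G′(β)/β`,
`G(s) = ζ₁(1+s)(s−β_j)ζ₁(1+s−β_j)⁻¹(P_μ/l₁)ˢ/log P_μ` (`Skeleton.cauchy_three_term`).
[cite: Zhang2022LandauSiegel, App. B p.107] -/
theorem circleIntegral_five_alpha_eq_gen : ∃ D₀ : ℕ, ∀ D : ℕ, D₀ ≤ D →
    ∀ j ∈ ({1, 2, 3} : Finset ℕ), ∀ (Pμ : ℝ) (l₁ : ℕ) (β : ℂ), 1 < Pμ → 1 ≤ l₁ → β ≠ 0 →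
      ‖β‖ ≤ 3 * alpha D →
      let G : ℂ → ℂ := fun s =>
        riemannZeta₁ (1 + s) * (s - betaJ c' D j) * (riemannZeta₁ (1 + s - betaJ c' D j))⁻¹ *
          ((Pμ / l₁ : ℝ) : ℂ) ^ s / (Real.log Pμ : ℂ)
      (2 * π * I)⁻¹ * (∮ s in C((0 : ℂ), 5 * alpha D), zetaRatio c' D j s * kerB Pμ β l₁ s) =
          G 0 / β ^ 2 - G β / β ^ 2 + deriv G β / β := by
  obtain ⟨δ, hδ, K, hK, hζ⟩ := zeta1_near_one
  refine ⟨⌈Real.exp (max (max 2 (60 * |c'| * π)) (max (10 * π / δ) (8 * K * π)))⌉₊,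
    fun D hD j hj Pμ l₁ β hPμ hl₁ hβ0 hβ3 => ?_⟩
  obtain ⟨hℓ2, hc, hδα, -, hα0, -, -⟩ := large_package c' hδ hK (le_ell_of_ceil_exp_le₅ hD)
  obtain ⟨-, hb4, hb2, -, -⟩ := betaJ_size c' hℓ2 hc hj
  set b := betaJ c' D j with hbdef
  set a := alpha D with hadef
  have hL0 : 0 < Real.log Pμ := Real.log_pos hPμ
  have hL : (Real.log Pμ : ℂ) ≠ 0 := by exact_mod_cast hL0.ne'
  have hx : 0 < Pμ / l₁ := by
    have hl : (0 : ℝ) < l₁ := by exact_mod_cast hl₁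
    have : 0 < Pμ := by linarith
    positivity
  -- `ζ₁(1 + s − β_j) ≠ 0` for `‖s‖ < 6α`
  have hzU : ∀ s ∈ ball (0 : ℂ) (6 * a), riemannZeta₁ (1 + s - b) ≠ 0 := by
    intro s hs
    have hs' : ‖s‖ < 6 * a := by simpa using hs
    have : ‖s - b‖ ≤ δ := by
      calc ‖s - b‖ ≤ ‖s‖ + ‖b‖ := norm_sub_le _ _
        _ ≤ 6 * a + 4 * a := by linarith
        _ ≤ δ := by linarith
    have := (hζ (s - b) this).2.2
    rwa [show (1 : ℂ) + (s - b) = 1 + s - b by ring] at this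
  have hGd := differentiableOn_G_gen c' D j hx (Real.log Pμ : ℂ) hzU
  have hU : IsOpen (ball (0 : ℂ) (6 * a)) := isOpen_ball
  have hbig0 : (0 : ℂ) ∈ ball (0 : ℂ) (5 * a) := mem_ball_self (by positivity)
  have hbigβ : β ∈ ball (0 : ℂ) (5 * a) := by
    rw [mem_ball_zero_iff]; linarith
  have hcl5 : closedBall (0 : ℂ) (5 * a) ⊆ ball (0 : ℂ) (6 * a) := closedBall_subset_ball (by linarith)
  have hnorm0 : ∀ R θ, ‖circleMap 0 R θ‖ = |R| := fun R θ => by simp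
  have hsph : ∀ θ, riemannZeta₁ (1 + circleMap 0 (5 * a) θ - b) ≠ 0 := by
    intro θ
    refine hzU _ ?_
    rw [mem_ball_zero_iff, hnorm0, abs_of_pos (by positivity)]; linarith
  have e5 : (∮ s in C((0 : ℂ), 5 * a), zetaRatio c' D j s * kerB Pμ β l₁ s) =
      ∮ s in C((0 : ℂ), 5 * a),
        (riemannZeta₁ (1 + s) * (s - b) * (riemannZeta₁ (1 + s - b))⁻¹ *
          ((Pμ / l₁ : ℝ) : ℂ) ^ s / (Real.log Pμ : ℂ)) / (s * (s - β) ^ 2) := by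
    refine circleIntegral_zetaRatio_kerB_eq_G c' D j Pμ β l₁ (by positivity) (fun θ h => ?_) hsph hL
    have := hnorm0 (5 * a) θ; rw [h, norm_zero, abs_of_pos (by positivity)] at this; linarith
  intro G
  rw [e5]
  exact cauchy_three_term hU hGd hcl5 hbig0 hbigβ hβ0

end GForm

/-! ## The small rectangle around `{0, β, β_j}` carries the circle integral -/

section Rect

variable (c' : ℝ)

/-- A point of norm `< r` with real part `< ε` lies in the open box `(−r, ε) × (−r, r)`. [folklore] -/
private theorem mem_box_of_norm_lt' {z : ℂ} {r ε : ℝ} (hz : ‖z‖ < r) (hε : z.re < ε) :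
    z ∈ Ioo (-r) ε ×ℂ Ioo (-r) r := by
  have hre := Complex.abs_re_le_norm z
  have him := Complex.abs_im_le_norm z
  rw [mem_reProdIm]
  exact ⟨⟨by linarith [neg_abs_le z.re], hε⟩,
    ⟨by linarith [neg_abs_le z.im], by linarith [le_abs_self z.im]⟩⟩

/-- The closed box `[−r, ε] × [−r, r]` (`0 < r`, `ε ≤ r`) lies in the open disc of radius `3r`.
[folklore] -/
private theorem box_subset_ball' {r ε : ℝ} (hr : 0 < r) (hε : ε ≤ r) :
    Icc (-r) ε ×ℂ Icc (-r) r ⊆ ball (0 : ℂ) (3 * r) := by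
  intro z hz
  rw [mem_reProdIm] at hz
  obtain ⟨⟨h1, h2⟩, ⟨h3, h4⟩⟩ := hz
  rw [mem_ball_zero_iff]
  have hre : |z.re| ≤ r := abs_le.mpr ⟨h1, h2.trans hε⟩
  have him : |z.im| ≤ r := abs_le.mpr ⟨h3, h4⟩
  calc ‖z‖ ≤ |z.re| + |z.im| := Complex.norm_le_abs_re_add_abs_im z
    _ ≤ r + r := add_le_add hre him
    _ < 3 * r := by linarith

/-- **The rectangle around the poles carries the circle integral, generic in `(P_μ, β)`.** There is an
absolute `δ₀ > 0` (a quarter of the radius of `Skeleton.zeta1_near_one`) such that for `D` large, every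
`j ∈ {1,2,3}`, `P_μ > 1`, `l₁ ≥ 1`, every purely imaginary `β ≠ 0`, `β ≠ β_j` with `‖β‖ ≤ 3α`, and every
`0 < ε ≤ δ₀`:
`∮_{∂([−δ₀, ε] × [−δ₀, δ₀])} ζ(1+s)/ζ(1+s−β_j)·(P_μ/l₁)ˢ/((log P_μ)(s−β)²) ds = ∮_{|s|=5α} (same)`
— inside the box the integrand is `G(s)/(s(s−β)²)` (simple pole at `0`, double pole at `β`, removable
point `β_j` with zero residue); both sides equal `2πi(G(0)/β² − G(β)/β² + G′(β)/β)`. The `μ = 2` case is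
zl-w15-p3's `Skeleton.intB2_rect_eq_circle`. [cite: Zhang2022LandauSiegel, App. B p.107] -/
theorem rect_eq_circle_gen : ∃ δ₀ : ℝ, 0 < δ₀ ∧ ∃ D₀ : ℕ, ∀ D : ℕ, D₀ ≤ D →
    ∀ j ∈ ({1, 2, 3} : Finset ℕ), ∀ (Pμ : ℝ) (l₁ : ℕ) (β : ℂ), 1 < Pμ → 1 ≤ l₁ → β ≠ 0 →
      β ≠ betaJ c' D j → β.re = 0 → ‖β‖ ≤ 3 * alpha D → ∀ ε : ℝ, 0 < ε → ε ≤ δ₀ →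
      rectBoundaryIntegral (fun s => zetaRatio c' D j s * kerB Pμ β l₁ s) (-δ₀) ε (-δ₀) δ₀ =
        ∮ s in C((0 : ℂ), 5 * alpha D), zetaRatio c' D j s * kerB Pμ β l₁ s := by
  obtain ⟨δ, hδ, K, hK, hζ⟩ := zeta1_near_one
  obtain ⟨D₁, hcirc⟩ := circleIntegral_five_alpha_eq_gen c'
  have hδ2 : 0 < δ / 2 := by positivity
  refine ⟨δ / 4, by positivity,
    max D₁ ⌈Real.exp (max (max 2 (60 * |c'| * π)) (max (10 * π / (δ / 2)) (8 * K * π)))⌉₊,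
    fun D hD j hj Pμ l₁ β hPμ hl₁ hβ0 hβb hβre hβ3 ε hε hεδ => ?_⟩
  have h5 := hcirc D (le_trans (le_max_left _ _) hD) j hj Pμ l₁ β hPμ hl₁ hβ0 hβ3
  obtain ⟨hℓ2, hc, hδα, -, hα0, -, -⟩ := large_package c' hδ2 hK
    (le_ell_of_ceil_exp_le₅ (le_trans (le_max_right _ _) hD))
  obtain ⟨-, hb4, hb2, -, -⟩ := betaJ_size c' hℓ2 hc hj
  -- notation
  set b := betaJ c' D j with hbdef
  set a := alpha D with hadef
  set r : ℝ := δ / 4 with hr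
  set F : ℂ → ℂ := fun s => zetaRatio c' D j s * kerB Pμ β l₁ s with hFdef
  have hr0 : 0 < r := by positivity
  have hαδ : 20 * a ≤ δ := by linarith only [hδα]
  have hL0 : 0 < Real.log Pμ := Real.log_pos hPμ
  have hL : (Real.log Pμ : ℂ) ≠ 0 := by exact_mod_cast hL0.ne'
  have hx : 0 < Pμ / l₁ := by
    have hl : (0 : ℝ) < l₁ := by exact_mod_cast hl₁
    have : 0 < Pμ := by linarith
    positivity
  have hb0 : b ≠ 0 := by intro h; rw [h, norm_zero] at hb2; linarith only [hb2, hα0]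
  -- `ζ₁(1 + s − b) ≠ 0` on the disc `|s| < 3r`, which contains the box
  have hzU : ∀ s ∈ ball (0 : ℂ) (3 * r), riemannZeta₁ (1 + s - b) ≠ 0 := by
    intro s hs
    have hs' : ‖s‖ < 3 * r := by simpa using hs
    have : ‖s - b‖ ≤ δ := by
      calc ‖s - b‖ ≤ ‖s‖ + ‖b‖ := norm_sub_le _ _
        _ ≤ 3 * r + 4 * a := by linarith only [hs', hb4]
        _ ≤ δ := by rw [hr]; linarith only [hαδ, hα0]
    have := (hζ (s - b) this).2.2
    rwa [show (1 : ℂ) + (s - b) = 1 + s - b by ring] at this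
  set G : ℂ → ℂ := fun s =>
    riemannZeta₁ (1 + s) * (s - b) * (riemannZeta₁ (1 + s - b))⁻¹ *
      ((Pμ / l₁ : ℝ) : ℂ) ^ s / (Real.log Pμ : ℂ) with hGdef
  have hGd : DifferentiableOn ℂ G (ball (0 : ℂ) (3 * r)) :=
    differentiableOn_G_gen c' D j hx (Real.log Pμ : ℂ) hzU
  have hU : IsOpen (ball (0 : ℂ) (3 * r)) := isOpen_ball
  have hKU : Icc (-r) ε ×ℂ Icc (-r) r ⊆ ball (0 : ℂ) (3 * r) := box_subset_ball' hr0 hεδ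
  -- the G-form of the integrand off `0` and `b`
  have hGform : ∀ s ∈ ball (0 : ℂ) (3 * r), s ≠ 0 → s ≠ b → F s = G s / (s * (s - β) ^ 2) := by
    intro s hs hs0 hsb
    exact zetaRatio_mul_kerB_eq_G_div c' D j Pμ β l₁ hs0 hsb (hzU s hs) hL
  -- the three special points lie in the open box
  have hn0 : ‖(0 : ℂ)‖ < r := by rw [norm_zero]; exact hr0
  have hnβ : ‖β‖ < r := by rw [hr]; linarith only [hβ3, hαδ, hα0]
  have hnb : ‖b‖ < r := by rw [hr]; linarith only [hb4, hαδ, hα0]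
  have hre0 : (0 : ℂ).re < ε := by simpa using hε
  have hreβ : β.re < ε := by rw [hβre]; exact hε
  have hreb : b.re < ε := by
    obtain ⟨t, ht, -⟩ := Typed.AppendixB.betaJ_bound c' D j hα0.le (by linarith only [hℓ2])
    rw [hbdef, ht, Complex.re_ofReal_mul, Complex.I_re, mul_zero]; exact hε
  set S : Finset ℂ := {0, β, b} with hSdef
  have hSsub : ((S : Set ℂ)) ⊆ Ioo (-r) ε ×ℂ Ioo (-r) r := by
    intro p hp
    simp only [hSdef, Finset.coe_insert, Finset.coe_singleton, mem_insert_iff,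
      mem_singleton_iff] at hp
    rcases hp with rfl | rfl | rfl
    · exact mem_box_of_norm_lt' hn0 hre0
    · exact mem_box_of_norm_lt' hnβ hreβ
    · exact mem_box_of_norm_lt' hnb hreb
  -- `F` is differentiable on the disc off `{0, β, b}`
  have hFd : DifferentiableOn ℂ F (ball (0 : ℂ) (3 * r) \ ↑S) := by
    intro s hs
    obtain ⟨hsU, hsS⟩ := hs
    simp only [hSdef, Finset.coe_insert, Finset.coe_singleton, mem_insert_iff,
      mem_singleton_iff, not_or] at hsS
    obtain ⟨hs0, hsβ, hsb⟩ := hsS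
    have hopen : IsOpen (ball (0 : ℂ) (3 * r) ∩ {z : ℂ | z ≠ 0 ∧ z ≠ b}) :=
      hU.inter (isOpen_ne.inter isOpen_ne)
    have hmem : s ∈ ball (0 : ℂ) (3 * r) ∩ {z : ℂ | z ≠ 0 ∧ z ≠ b} := ⟨hsU, hs0, hsb⟩
    have heq : F =ᶠ[𝓝 s] fun z => G z / (z * (z - β) ^ 2) := by
      refine Filter.eventuallyEq_of_mem (hopen.mem_nhds hmem) fun z hz => ?_
      exact hGform z hz.1 hz.2.1 hz.2.2
    have hGs : DifferentiableAt ℂ G s := hGd.differentiableAt (hU.mem_nhds hsU)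
    have hden : DifferentiableAt ℂ (fun z : ℂ => z * (z - β) ^ 2) s :=
      differentiableAt_id.mul ((differentiableAt_id.sub_const β).pow 2)
    have hden0 : s * (s - β) ^ 2 ≠ 0 :=
      mul_ne_zero hs0 (pow_ne_zero _ (sub_ne_zero.mpr hsβ))
    exact ((hGs.div hden hden0).congr_of_eventuallyEq heq).differentiableWithinAt
  -- residue data
  set res : ℂ → ℂ := fun p =>
    if p = 0 then G 0 / β ^ 2 else if p = β then deriv G β / β - G β / β ^ 2 else 0 with hresdef
  have hpole : ∀ p ∈ S, ∃ φ : ℂ → ℂ, ∃ V ∈ 𝓝 p, DifferentiableOn ℂ φ V ∧ deriv φ p = res p ∧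
      ∀ z ∈ V, z ≠ p → F z = φ z / (z - p) ^ 2 := by
    intro p hp
    simp only [hSdef, Finset.mem_insert, Finset.mem_singleton] at hp
    rcases hp with rfl | hpβ | rfl
    · -- simple pole at `0`: `F = ψ/(z − 0)` with `ψ = G/(z−β)²`
      have hV : ball (0 : ℂ) (3 * r) ∩ {z : ℂ | z ≠ b ∧ z ≠ β} ∈ 𝓝 (0 : ℂ) :=
        (hU.inter (isOpen_ne.inter isOpen_ne)).mem_nhds
          ⟨mem_ball_self (by positivity), hb0.symm, hβ0.symm⟩
      have hψ : DifferentiableOn ℂ (fun z => G z / (z - β) ^ 2)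
          (ball (0 : ℂ) (3 * r) ∩ {z : ℂ | z ≠ b ∧ z ≠ β}) := by
        intro z hz
        have hGz : DifferentiableAt ℂ G z := hGd.differentiableAt (hU.mem_nhds hz.1)
        exact (hGz.div ((differentiableAt_id.sub_const β).pow 2)
          (pow_ne_zero _ (sub_ne_zero.mpr hz.2.2))).differentiableWithinAt
      have hF0 : ∀ z ∈ ball (0 : ℂ) (3 * r) ∩ {z : ℂ | z ≠ b ∧ z ≠ β}, z ≠ 0 →
          F z = G z / (z - β) ^ 2 / (z - 0) := by
        intro z hz hz0
        rw [hGform z hz.1 hz0 hz.2.1, sub_zero]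
        have h1 : z - β ≠ 0 := sub_ne_zero.mpr hz.2.2
        field_simp
      obtain ⟨φ, W, hW, hφd, hφ', hF⟩ := doublePole_data_of_simplePole hV hψ hF0
      refine ⟨φ, W, hW, hφd, ?_, hF⟩
      rw [hφ', hresdef]
      simp only [if_true, zero_sub, neg_sq]
    · -- double pole at `β`: `F = φ/(z − β)²` with `φ = G/z`
      rw [hpβ]
      have hV : ball (0 : ℂ) (3 * r) ∩ {z : ℂ | z ≠ 0 ∧ z ≠ b} ∈ 𝓝 β :=
        (hU.inter (isOpen_ne.inter isOpen_ne)).mem_nhds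
          ⟨by simpa using (show ‖β‖ < 3 * r by linarith only [hnβ, hr0]), hβ0, hβb⟩
      refine ⟨fun z => G z / z, _, hV, ?_, ?_, ?_⟩
      · intro z hz
        have hGz : DifferentiableAt ℂ G z := hGd.differentiableAt (hU.mem_nhds hz.1)
        exact (hGz.div differentiableAt_id hz.2.1).differentiableWithinAt
      · have hGβ : DifferentiableAt ℂ G β :=
          hGd.differentiableAt (hU.mem_nhds
            (by simpa using (show ‖β‖ < 3 * r by linarith only [hnβ, hr0])))
        have hd : HasDerivAt (fun z => G z / z) ((deriv G β * β - G β * 1) / β ^ 2) β :=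
          hGβ.hasDerivAt.div (hasDerivAt_id β) hβ0
        rw [hd.deriv, hresdef]
        simp only [hβ0, if_false, if_true]
        rw [div_sub_div _ _ hβ0 (pow_ne_zero 2 hβ0), div_eq_div_iff (pow_ne_zero 2 hβ0)
          (mul_ne_zero hβ0 (pow_ne_zero 2 hβ0))]
        ring
      · intro z hz hzβ
        rw [hGform z hz.1 hz.2.1 hz.2.2]
        have h1 : z - β ≠ 0 := sub_ne_zero.mpr hzβ
        have h2 : z ≠ 0 := hz.2.1
        field_simp
    · -- removable point `b`: `F = ψ/(z − b)` with `ψ = (z − b)·G/(z(z−β)²)`, `ψ(b) = 0`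
      have hV : ball (0 : ℂ) (3 * r) ∩ {z : ℂ | z ≠ 0 ∧ z ≠ β} ∈ 𝓝 b :=
        (hU.inter (isOpen_ne.inter isOpen_ne)).mem_nhds
          ⟨by simpa using (show ‖b‖ < 3 * r by linarith only [hnb, hr0]), hb0, hβb.symm⟩
      have hψ : DifferentiableOn ℂ (fun z => (z - b) * (G z / (z * (z - β) ^ 2)))
          (ball (0 : ℂ) (3 * r) ∩ {z : ℂ | z ≠ 0 ∧ z ≠ β}) := by
        intro z hz
        have hGz : DifferentiableAt ℂ G z := hGd.differentiableAt (hU.mem_nhds hz.1)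
        have hden : DifferentiableAt ℂ (fun w : ℂ => w * (w - β) ^ 2) z :=
          differentiableAt_id.mul ((differentiableAt_id.sub_const β).pow 2)
        exact ((differentiableAt_id.sub_const b).mul (hGz.div hden
          (mul_ne_zero hz.2.1 (pow_ne_zero _ (sub_ne_zero.mpr hz.2.2))))).differentiableWithinAt
      have hFb : ∀ z ∈ ball (0 : ℂ) (3 * r) ∩ {z : ℂ | z ≠ 0 ∧ z ≠ β}, z ≠ b →
          F z = (z - b) * (G z / (z * (z - β) ^ 2)) / (z - b) := by
        intro z hz hzb
        rw [hGform z hz.1 hz.2.1 hzb]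
        have h1 : z - b ≠ 0 := sub_ne_zero.mpr hzb
        field_simp
      obtain ⟨φ, W, hW, hφd, hφ', hF⟩ := doublePole_data_of_simplePole hV hψ hFb
      refine ⟨φ, W, hW, hφd, ?_, hF⟩
      rw [hφ', hresdef]
      simp only [sub_self, zero_mul, hb0, if_false, hβb.symm]
  -- the residue theorem on the box
  have hrect := rectBoundaryIntegral_eq_sum_of_doublePoles (a := -r) (b := ε) (c := -r) (d := r)
    (by linarith only [hr0, hε]) (by linarith only [hr0]) S F res
    (ball (0 : ℂ) (3 * r)) hU hKU hSsub hFd hpole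
  -- the sum of the residues
  have hS0β : (0 : ℂ) ∉ ({β, b} : Finset ℂ) := by
    simp only [Finset.mem_insert, Finset.mem_singleton, not_or]
    exact ⟨hβ0.symm, hb0.symm⟩
  have hSβb : β ∉ ({b} : Finset ℂ) := by simpa using hβb
  have hres0 : res 0 = G 0 / β ^ 2 := by simp only [hresdef, if_true]
  have hresβ : res β = deriv G β / β - G β / β ^ 2 := by
    simp only [hresdef, hβ0, if_false, if_true]
  have hresb : res b = 0 := by simp only [hresdef, hb0, if_false, hβb.symm]
  have hsum : ∑ p ∈ S, res p = G 0 / β ^ 2 - G β / β ^ 2 + deriv G β / β := by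
    rw [hSdef, Finset.sum_insert hS0β, Finset.sum_insert hSβb, Finset.sum_singleton, hres0, hresβ,
      hresb]
    ring
  rw [hrect, hsum]
  -- and the circle has the same closed form
  have h2πI : (2 * π * I : ℂ) ≠ 0 := by
    apply mul_ne_zero (mul_ne_zero two_ne_zero _) Complex.I_ne_zero
    exact_mod_cast Real.pi_ne_zero
  have h5' : (∮ s in C((0 : ℂ), 5 * a), F s) =
      2 * π * I * (G 0 / β ^ 2 - G β / β ^ 2 + deriv G β / β) := by
    rw [← h5, ← mul_assoc, mul_inv_cancel₀ h2πI, one_mul]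
  rw [h5']


/-! ## Boxes of any smaller half-size (the box used by the line-to-circle estimates) -/

/-- **Pointwise core of `rect_eq_circle_gen`** (no largeness bookkeeping): if `ζ₁(1+s−β_j) ≠ 0` on the disc
`|s| < 3r`, the three points `0, β, β_j` are pairwise distinct, non-zero where needed, of real part `< ε`
and of norm `< r`, `0 < ε ≤ r`, `log P_μ ≠ 0`, `P_μ/l₁ > 0`, and the circle `|s| = 5α` has the closed
`G`-form value, then the box `[−r, ε] × [−r, r]` carries the circle integral.
[cite: Zhang2022LandauSiegel, App. B p.107] -/
theorem rect_eq_circle_core {D j : ℕ} {Pμ : ℝ} {l₁ : ℕ} {β : ℂ} {r ε : ℝ} (hr0 : 0 < r)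
    (hε : 0 < ε) (hεr : ε ≤ r) (hL : (Real.log Pμ : ℂ) ≠ 0) (hx : 0 < Pμ / l₁)
    (hβ0 : β ≠ 0) (hβb : β ≠ betaJ c' D j) (hb0 : betaJ c' D j ≠ 0)
    (hnβ : ‖β‖ < r) (hnb : ‖betaJ c' D j‖ < r) (hreβ : β.re < ε) (hreb : (betaJ c' D j).re < ε)
    (hzU : ∀ s ∈ ball (0 : ℂ) (3 * r), riemannZeta₁ (1 + s - betaJ c' D j) ≠ 0)
    (h5 : let G : ℂ → ℂ := fun s =>
        riemannZeta₁ (1 + s) * (s - betaJ c' D j) * (riemannZeta₁ (1 + s - betaJ c' D j))⁻¹ *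
          ((Pμ / l₁ : ℝ) : ℂ) ^ s / (Real.log Pμ : ℂ)
      (2 * π * I)⁻¹ * (∮ s in C((0 : ℂ), 5 * alpha D), zetaRatio c' D j s * kerB Pμ β l₁ s) =
          G 0 / β ^ 2 - G β / β ^ 2 + deriv G β / β) :
    rectBoundaryIntegral (fun s => zetaRatio c' D j s * kerB Pμ β l₁ s) (-r) ε (-r) r =
      ∮ s in C((0 : ℂ), 5 * alpha D), zetaRatio c' D j s * kerB Pμ β l₁ s := by
  set b := betaJ c' D j with hbdef
  set a := alpha D with hadef
  set F : ℂ → ℂ := fun s => zetaRatio c' D j s * kerB Pμ β l₁ s with hFdef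
  set G : ℂ → ℂ := fun s =>
    riemannZeta₁ (1 + s) * (s - b) * (riemannZeta₁ (1 + s - b))⁻¹ *
      ((Pμ / l₁ : ℝ) : ℂ) ^ s / (Real.log Pμ : ℂ) with hGdef
  have hGd : DifferentiableOn ℂ G (ball (0 : ℂ) (3 * r)) :=
    differentiableOn_G_gen c' D j hx (Real.log Pμ : ℂ) hzU
  have hU : IsOpen (ball (0 : ℂ) (3 * r)) := isOpen_ball
  have hKU : Icc (-r) ε ×ℂ Icc (-r) r ⊆ ball (0 : ℂ) (3 * r) := box_subset_ball' hr0 hεr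
  -- the G-form of the integrand off `0` and `b`
  have hGform : ∀ s ∈ ball (0 : ℂ) (3 * r), s ≠ 0 → s ≠ b → F s = G s / (s * (s - β) ^ 2) := by
    intro s hs hs0 hsb
    exact zetaRatio_mul_kerB_eq_G_div c' D j Pμ β l₁ hs0 hsb (hzU s hs) hL
  -- the three special points lie in the open box
  have hn0 : ‖(0 : ℂ)‖ < r := by rw [norm_zero]; exact hr0
  have hre0 : (0 : ℂ).re < ε := by simpa using hε
  set S : Finset ℂ := {0, β, b} with hSdef
  have hSsub : ((S : Set ℂ)) ⊆ Ioo (-r) ε ×ℂ Ioo (-r) r := by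
    intro p hp
    simp only [hSdef, Finset.coe_insert, Finset.coe_singleton, mem_insert_iff,
      mem_singleton_iff] at hp
    rcases hp with rfl | rfl | rfl
    · exact mem_box_of_norm_lt' hn0 hre0
    · exact mem_box_of_norm_lt' hnβ hreβ
    · exact mem_box_of_norm_lt' hnb hreb
  -- `F` is differentiable on the disc off `{0, β, b}`
  have hFd : DifferentiableOn ℂ F (ball (0 : ℂ) (3 * r) \ ↑S) := by
    intro s hs
    obtain ⟨hsU, hsS⟩ := hs
    simp only [hSdef, Finset.coe_insert, Finset.coe_singleton, mem_insert_iff,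
      mem_singleton_iff, not_or] at hsS
    obtain ⟨hs0, hsβ, hsb⟩ := hsS
    have hopen : IsOpen (ball (0 : ℂ) (3 * r) ∩ {z : ℂ | z ≠ 0 ∧ z ≠ b}) :=
      hU.inter (isOpen_ne.inter isOpen_ne)
    have hmem : s ∈ ball (0 : ℂ) (3 * r) ∩ {z : ℂ | z ≠ 0 ∧ z ≠ b} := ⟨hsU, hs0, hsb⟩
    have heq : F =ᶠ[𝓝 s] fun z => G z / (z * (z - β) ^ 2) := by
      refine Filter.eventuallyEq_of_mem (hopen.mem_nhds hmem) fun z hz => ?_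
      exact hGform z hz.1 hz.2.1 hz.2.2
    have hGs : DifferentiableAt ℂ G s := hGd.differentiableAt (hU.mem_nhds hsU)
    have hden : DifferentiableAt ℂ (fun z : ℂ => z * (z - β) ^ 2) s :=
      differentiableAt_id.mul ((differentiableAt_id.sub_const β).pow 2)
    have hden0 : s * (s - β) ^ 2 ≠ 0 :=
      mul_ne_zero hs0 (pow_ne_zero _ (sub_ne_zero.mpr hsβ))
    exact ((hGs.div hden hden0).congr_of_eventuallyEq heq).differentiableWithinAt
  -- residue data
  set res : ℂ → ℂ := fun p =>
    if p = 0 then G 0 / β ^ 2 else if p = β then deriv G β / β - G β / β ^ 2 else 0 with hresdef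
  have hpole : ∀ p ∈ S, ∃ φ : ℂ → ℂ, ∃ V ∈ 𝓝 p, DifferentiableOn ℂ φ V ∧ deriv φ p = res p ∧
      ∀ z ∈ V, z ≠ p → F z = φ z / (z - p) ^ 2 := by
    intro p hp
    simp only [hSdef, Finset.mem_insert, Finset.mem_singleton] at hp
    rcases hp with rfl | hpβ | rfl
    · -- simple pole at `0`
      have hV : ball (0 : ℂ) (3 * r) ∩ {z : ℂ | z ≠ b ∧ z ≠ β} ∈ 𝓝 (0 : ℂ) :=
        (hU.inter (isOpen_ne.inter isOpen_ne)).mem_nhds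
          ⟨mem_ball_self (by positivity), hb0.symm, hβ0.symm⟩
      have hψ : DifferentiableOn ℂ (fun z => G z / (z - β) ^ 2)
          (ball (0 : ℂ) (3 * r) ∩ {z : ℂ | z ≠ b ∧ z ≠ β}) := by
        intro z hz
        have hGz : DifferentiableAt ℂ G z := hGd.differentiableAt (hU.mem_nhds hz.1)
        exact (hGz.div ((differentiableAt_id.sub_const β).pow 2)
          (pow_ne_zero _ (sub_ne_zero.mpr hz.2.2))).differentiableWithinAt
      have hF0 : ∀ z ∈ ball (0 : ℂ) (3 * r) ∩ {z : ℂ | z ≠ b ∧ z ≠ β}, z ≠ 0 →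
          F z = G z / (z - β) ^ 2 / (z - 0) := by
        intro z hz hz0
        rw [hGform z hz.1 hz0 hz.2.1, sub_zero]
        have h1 : z - β ≠ 0 := sub_ne_zero.mpr hz.2.2
        field_simp
      obtain ⟨φ, W, hW, hφd, hφ', hF⟩ := doublePole_data_of_simplePole hV hψ hF0
      refine ⟨φ, W, hW, hφd, ?_, hF⟩
      rw [hφ', hresdef]
      simp only [if_true, zero_sub, neg_sq]
    · -- double pole at `β`
      rw [hpβ]
      have hV : ball (0 : ℂ) (3 * r) ∩ {z : ℂ | z ≠ 0 ∧ z ≠ b} ∈ 𝓝 β :=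
        (hU.inter (isOpen_ne.inter isOpen_ne)).mem_nhds
          ⟨by simpa using (show ‖β‖ < 3 * r by linarith only [hnβ, hr0]), hβ0, hβb⟩
      refine ⟨fun z => G z / z, _, hV, ?_, ?_, ?_⟩
      · intro z hz
        have hGz : DifferentiableAt ℂ G z := hGd.differentiableAt (hU.mem_nhds hz.1)
        exact (hGz.div differentiableAt_id hz.2.1).differentiableWithinAt
      · have hGβ : DifferentiableAt ℂ G β :=
          hGd.differentiableAt (hU.mem_nhds
            (by simpa using (show ‖β‖ < 3 * r by linarith only [hnβ, hr0])))
        have hd : HasDerivAt (fun z => G z / z) ((deriv G β * β - G β * 1) / β ^ 2) β :=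
          hGβ.hasDerivAt.div (hasDerivAt_id β) hβ0
        rw [hd.deriv, hresdef]
        simp only [hβ0, if_false, if_true]
        rw [div_sub_div _ _ hβ0 (pow_ne_zero 2 hβ0), div_eq_div_iff (pow_ne_zero 2 hβ0)
          (mul_ne_zero hβ0 (pow_ne_zero 2 hβ0))]
        ring
      · intro z hz hzβ
        rw [hGform z hz.1 hz.2.1 hz.2.2]
        have h1 : z - β ≠ 0 := sub_ne_zero.mpr hzβ
        have h2 : z ≠ 0 := hz.2.1
        field_simp
    · -- removable point `b`
      have hV : ball (0 : ℂ) (3 * r) ∩ {z : ℂ | z ≠ 0 ∧ z ≠ β} ∈ 𝓝 b :=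
        (hU.inter (isOpen_ne.inter isOpen_ne)).mem_nhds
          ⟨by simpa using (show ‖b‖ < 3 * r by linarith only [hnb, hr0]), hb0, hβb.symm⟩
      have hψ : DifferentiableOn ℂ (fun z => (z - b) * (G z / (z * (z - β) ^ 2)))
          (ball (0 : ℂ) (3 * r) ∩ {z : ℂ | z ≠ 0 ∧ z ≠ β}) := by
        intro z hz
        have hGz : DifferentiableAt ℂ G z := hGd.differentiableAt (hU.mem_nhds hz.1)
        have hden : DifferentiableAt ℂ (fun w : ℂ => w * (w - β) ^ 2) z :=
          differentiableAt_id.mul ((differentiableAt_id.sub_const β).pow 2)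
        exact ((differentiableAt_id.sub_const b).mul (hGz.div hden
          (mul_ne_zero hz.2.1 (pow_ne_zero _ (sub_ne_zero.mpr hz.2.2))))).differentiableWithinAt
      have hFb : ∀ z ∈ ball (0 : ℂ) (3 * r) ∩ {z : ℂ | z ≠ 0 ∧ z ≠ β}, z ≠ b →
          F z = (z - b) * (G z / (z * (z - β) ^ 2)) / (z - b) := by
        intro z hz hzb
        rw [hGform z hz.1 hz.2.1 hzb]
        have h1 : z - b ≠ 0 := sub_ne_zero.mpr hzb
        field_simp
      obtain ⟨φ, W, hW, hφd, hφ', hF⟩ := doublePole_data_of_simplePole hV hψ hFb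
      refine ⟨φ, W, hW, hφd, ?_, hF⟩
      rw [hφ', hresdef]
      simp only [sub_self, zero_mul, hb0, if_false, hβb.symm]
  -- the residue theorem on the box
  have hrect := rectBoundaryIntegral_eq_sum_of_doublePoles (a := -r) (b := ε) (c := -r) (d := r)
    (by linarith only [hr0, hε]) (by linarith only [hr0]) S F res
    (ball (0 : ℂ) (3 * r)) hU hKU hSsub hFd hpole
  -- the sum of the residues
  have hS0β : (0 : ℂ) ∉ ({β, b} : Finset ℂ) := by
    simp only [Finset.mem_insert, Finset.mem_singleton, not_or]
    exact ⟨hβ0.symm, hb0.symm⟩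
  have hSβb : β ∉ ({b} : Finset ℂ) := by simpa using hβb
  have hres0 : res 0 = G 0 / β ^ 2 := by simp only [hresdef, if_true]
  have hresβ : res β = deriv G β / β - G β / β ^ 2 := by
    simp only [hresdef, hβ0, if_false, if_true]
  have hresb : res b = 0 := by simp only [hresdef, hb0, if_false, hβb.symm]
  have hsum : ∑ p ∈ S, res p = G 0 / β ^ 2 - G β / β ^ 2 + deriv G β / β := by
    rw [hSdef, Finset.sum_insert hS0β, Finset.sum_insert hSβb, Finset.sum_singleton, hres0, hresβ,
      hresb]
    ring
  rw [hrect, hsum]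
  have h2πI : (2 * π * I : ℂ) ≠ 0 := by
    apply mul_ne_zero (mul_ne_zero two_ne_zero _) Complex.I_ne_zero
    exact_mod_cast Real.pi_ne_zero
  have h5' : (∮ s in C((0 : ℂ), 5 * a), F s) =
      2 * π * I * (G 0 / β ^ 2 - G β / β ^ 2 + deriv G β / β) := by
    rw [← h5, ← mul_assoc, mul_inv_cancel₀ h2πI, one_mul]
  rw [h5']

/-- **The rectangle around the poles carries the circle integral — boxes of any smaller half-size**, with
the provenance of the box size exported: there is an absolute `δ₀ > 0` with `ζ₁(1+z) ≠ 0` for `|z| ≤ 4δ₀`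
(`Skeleton.zeta1_near_one`), such that for every `0 < δ′ ≤ δ₀` (the threshold in `D` then depends on `δ′`,
which must dominate `5α`), for `D` large, `j ∈ {1,2,3}`, `P_μ > 1`, `l₁ ≥ 1`, `β ≠ 0`, `β ≠ β_j`, `Re β = 0`,
`‖β‖ ≤ 3α` and `0 < ε ≤ δ′`:
`∮_{∂([−δ′, ε] × [−δ′, δ′])} ζ(1+s)/ζ(1+s−β_j)·(P_μ/l₁)ˢ/((log P_μ)(s−β)²) ds = ∮_{|s|=5α} (same)`.
(This is the form consumed by the line-to-box estimates of `AppendixBLineToCircleGeneric`, whose box must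
also sit inside the classical zero-free region.) [cite: Zhang2022LandauSiegel, App. B p.107] -/
theorem rect_eq_circle_gen_of_le : ∃ δ₀ : ℝ, 0 < δ₀ ∧
    (∀ z : ℂ, ‖z‖ ≤ 4 * δ₀ → riemannZeta₁ (1 + z) ≠ 0) ∧
    ∀ δ' : ℝ, 0 < δ' → δ' ≤ δ₀ → ∃ D₀ : ℕ, ∀ D : ℕ, D₀ ≤ D →
      ∀ j ∈ ({1, 2, 3} : Finset ℕ), ∀ (Pμ : ℝ) (l₁ : ℕ) (β : ℂ), 1 < Pμ → 1 ≤ l₁ → β ≠ 0 →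
        β ≠ betaJ c' D j → β.re = 0 → ‖β‖ ≤ 3 * alpha D → ∀ ε : ℝ, 0 < ε → ε ≤ δ' →
        rectBoundaryIntegral (fun s => zetaRatio c' D j s * kerB Pμ β l₁ s) (-δ') ε (-δ') δ' =
          ∮ s in C((0 : ℂ), 5 * alpha D), zetaRatio c' D j s * kerB Pμ β l₁ s := by
  obtain ⟨δ, hδ, K, hK, hζ⟩ := zeta1_near_one
  obtain ⟨D₁, hcirc⟩ := circleIntegral_five_alpha_eq_gen c'
  refine ⟨δ / 4, by positivity, fun z hz => (hζ z (by linarith)).2.2, fun δ' hδ' hδ'δ => ?_⟩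
  have h2δ' : 0 < 2 * δ' := by positivity
  refine ⟨max D₁ ⌈Real.exp (max (max 2 (60 * |c'| * π)) (max (10 * π / (2 * δ')) (8 * K * π)))⌉₊,
    fun D hD j hj Pμ l₁ β hPμ hl₁ hβ0 hβb hβre hβ3 ε hε hεδ => ?_⟩
  have h5 := hcirc D (le_trans (le_max_left _ _) hD) j hj Pμ l₁ β hPμ hl₁ hβ0 hβ3
  obtain ⟨hℓ2, hc, hδα, -, hα0, -, -⟩ := large_package c' h2δ' hK
    (le_ell_of_ceil_exp_le₅ (le_trans (le_max_right _ _) hD))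
  obtain ⟨-, hb4, hb2, -, -⟩ := betaJ_size c' hℓ2 hc hj
  set b := betaJ c' D j with hbdef
  set a := alpha D with hadef
  have h5a : 5 * a ≤ δ' := by linarith only [hδα]
  have hL0 : 0 < Real.log Pμ := Real.log_pos hPμ
  have hL : (Real.log Pμ : ℂ) ≠ 0 := by exact_mod_cast hL0.ne'
  have hx : 0 < Pμ / l₁ := by
    have hl : (0 : ℝ) < l₁ := by exact_mod_cast hl₁
    have : 0 < Pμ := by linarith
    positivity
  have hb0 : b ≠ 0 := by intro h; rw [h, norm_zero] at hb2; linarith only [hb2, hα0]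
  -- `ζ₁(1 + s − b) ≠ 0` on the disc `|s| < 3δ′ ≤ 3δ/4`
  have hzU : ∀ s ∈ ball (0 : ℂ) (3 * δ'), riemannZeta₁ (1 + s - b) ≠ 0 := by
    intro s hs
    have hs' : ‖s‖ < 3 * δ' := by simpa using hs
    have : ‖s - b‖ ≤ δ := by
      calc ‖s - b‖ ≤ ‖s‖ + ‖b‖ := norm_sub_le _ _
        _ ≤ 3 * δ' + 4 * a := by linarith only [hs', hb4]
        _ ≤ δ := by linarith only [hδ'δ, h5a, hα0]
    have := (hζ (s - b) this).2.2
    rwa [show (1 : ℂ) + (s - b) = 1 + s - b by ring] at this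
  have hnβ : ‖β‖ < δ' := by linarith only [hβ3, h5a, hα0]
  have hnb : ‖b‖ < δ' := by linarith only [hb4, h5a, hα0]
  have hreβ : β.re < ε := by rw [hβre]; exact hε
  have hreb : b.re < ε := by
    obtain ⟨t, ht, -⟩ := Typed.AppendixB.betaJ_bound c' D j hα0.le (by linarith only [hℓ2])
    rw [hbdef, ht, Complex.re_ofReal_mul, Complex.I_re, mul_zero]; exact hε
  exact rect_eq_circle_core c' hδ' hε hεδ hL hx hβ0 hβb hb0 hnβ hnb hreβ hreb hzU h5

end Rect

end Literature.NumberTheory.LFunctions.Zhang2022.Typed.AppendixB
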